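import Summits.Ventures.CertifiedManyBodySolver.Downfold.EmeryOxygenRayShapeLever
import Summits.Ventures.CertifiedManyBodySolver.Downfold.EmeryTppPrimeShapeLever
import HarnessLib

/-!
# THE TWO-RAY RULE FOR OBJECT E OVER A TYPED THREE-BAND BOX: every member's fixed-doping one-band `t′/t` lies between the values at the two
# explicit rows `(Δ₁, a₁, b₂, c·b₂/b)` and `(Δ₂, a₂, b₁, c·b₁/b)` — pure boxes: an exact two-corner rule; `t_pp′ > 0` boxes: two VIRTUAL corners with
# `t_pp′` inflated by the relative `t_pp` width `b₂/b₁` (the explicit 3 → 1 box inflation of technique B for the Fermi-surface shape)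

Venture CertifiedManyBodySolver, cell `pub/hubbard-downfold` (stage S1; INFLATION-RULES-3to1-B §B.86), seat hubbard-downfold-mod-4 (technique B = band level,
g35); namespace `Summit.Ventures.CertifiedManyBodySolver.Downfold.Emery`. Everything PROVED (0 sorry, no definition). WHAT THIS IS NOT: a statement about
any material; `U = 0` one-body kinematics of the σ (d–p_x–p_y + t_pp, t_pp′) model; no number lives here.

THE SEAT'S ROW («three-band ↦ single-band reduction with the reduction error carried as an explicit inflation of the single-band box») FOR THE SHAPE
COORDINATE. A typed 3BE box is `[Δ₁, Δ₂] × [a₁, a₂] × [b₁, b₂] × [c₁, c₂] ∋ (Δ, t_pd, t_pp, t_pp′)`; the single-band image of a member at hole doping `x` is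
(object E) the EXACT Fermi-surface `t′/t`, `R(θ) = fsRatio(θ; fermiEnergyOf(θ; (1 − x)/2))`. Three certificate-free levers are in the tree — `Δ ↑ ⇒ R ↑`
(§B.83 (g)), `t_pd ↑ ⇒ R ↑` (§B.85 (e)), oxygen ray `(t_pp, t_pp′) ↦ λ(t_pp, t_pp′) ⇒ R ↓` (§B.85 (h)) — and they compose into:

* §1 **THE TWO-RAY RULE** (`fsRatio_fermiEnergyOf_twoRay_lower/upper`, `…_twoRay`): for every member `θ = (Δ, a, b, c)` (sheet regime in the single form
  `c₂·b₂·ε_F(Δ₁, a₂, b₂, c₁) ≤ a₁²·b₁`, i.e. at the box's Fermi-energy HIGH corner of §B.83 (k)):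
  **`R(Δ₁, a₁, b₂, c·b₂/b) ≤ R(θ) ≤ R(Δ₂, a₂, b₁, c·b₁/b)`** — the member is squeezed between two rows ON ITS OWN OXYGEN RAY `t_pp′/t_pp = c/b`, at the
  opposite `(Δ, t_pd)` corners and the opposite `t_pp` ends.
* §2 **PURE BOXES** (`t_pp′ = 0` throughout; `fsRatio_fermiEnergyOf_mem_Icc_pureBox`): `R ∈ [R(Δ₁, a₁, b₂, 0), R(Δ₂, a₂, b₁, 0)]` — TWO TRUE CORNERS, no regime
  hypothesis, and EXACT (both corners are members): the `t_pd` width has folded into the corners, the census at two points bounds the box.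
* §3 **FIXED-RATIO BOXES** (`t_pp′ = κ·t_pp` for every member, `0 ≤ κ ≤ 1`; `…_mem_Icc_fixedRatioBox`): `R ∈ [R(Δ₁, a₁, b₂, κb₂), R(Δ₂, a₂, b₁, κb₁)]` — again two
  members, exact.
* §4 **GENERAL BOXES — TWO VIRTUAL CORNERS** (`fsRatio_fermiEnergyOf_mem_Icc_virtualCorners`): since `c·b₂/b ∈ [c₁, c₂b₂/b₁]` and `c·b₁/b ∈ [c₁b₁/b₂, c₂]`, the
  conditional `t_pp′` lever (§B.85 (m)) collapses the two rays onto the rows **`V_lo = (Δ₁, a₁, b₂, c₂·b₂/b₁)`** and **`V_hi = (Δ₂, a₂, b₁, c₁·b₁/b₂)`**: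
  `R ∈ [R(V_lo), R(V_hi)]` under two finitely-checkable side conditions — the doping discriminant `≤ 0` at the four corners of a Fermi-energy bracket of
  the fixed row `V_lo` (two `pointBracketCheck`s) and ONE rational slab inequality for the rows `(Δ₂, a₂, b₁, c′)`, `c′ ∈ [c₁b₁/b₂, c₂]`
  (`dopingDisc_nonpos_on_slab`). `V_lo`, `V_hi` lie OUTSIDE the typed box in the `t_pp′` coordinate by the factor `b₂/b₁` resp. `b₁/b₂`: THAT is the
  explicit inflation this technique pays for not signing `t_pp` alone at `t_pp′ > 0` (§B.85 (l)); it vanishes for pure and fixed-ratio boxes.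
  Instance: `EmeryBoxesLa214ShapeCorners` (La₂CuO₄ 3BE box, x = 0, 1/8, 0.22).

Sources: three-band model [HybertsenSchluterChristensen1989, Eq. (1)]; contour form [AndersenEtAl1995, §6]; arithmetic [folklore].
-/

noncomputable section

namespace Summit.Ventures.CertifiedManyBodySolver.Downfold.Emery

open Real Set

/-! ## §0 Certificate-free one-step levers of the Fermi energy in endpoint form (conveniences) -/

section Conveniences

variable {Δ a b c ν : ℝ}

/-- `ε_F` is non-increasing in `t_pp′`, endpoint form, certificate-free: `c ≤ c′ ⇒ ε_F(c′) ≤ ε_F(c)`. [folklore] -/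
theorem fermiEnergyOf_anti_tppP' {c' : ℝ} (hΔ : 0 < Δ) (ha : a ≠ 0) (hc : 0 ≤ c) (hcc : c ≤ c') (hb : 0 ≤ b) (hν0 : 0 < ν) (hν1 : ν < 1) :
    fermiEnergyOf Δ a b c' ν ≤ fermiEnergyOf Δ a b c ν := by
  obtain ⟨e1, -, he1⟩ := exists_fermiEnergy_of_mem_Ioo hΔ ha hc hb hν0 hν1
  obtain ⟨e2, -, he2⟩ := exists_fermiEnergy_of_mem_Ioo hΔ ha (hc.trans hcc) hb hν0 hν1
  have h := fermiEnergyOf_anti_tppP (γ := c' - c) hΔ ha hc hb (by linarith) hν0 hν1 ⟨e1, he1⟩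
    (by rw [show c + (c' - c) = c' by ring]; exact ⟨e2, he2⟩)
  rwa [show c + (c' - c) = c' by ring] at h

/-- `ε_F` is non-decreasing in `t_pd`, endpoint form, certificate-free: `0 < a ≤ a′ ⇒ ε_F(a) ≤ ε_F(a′)`. [folklore] -/
theorem fermiEnergyOf_mono_tpd' {a' : ℝ} (hΔ : 0 < Δ) (ha : 0 < a) (haa : a ≤ a') (hc : 0 ≤ c) (hb : 0 ≤ b) (hν0 : 0 < ν) (hν1 : ν < 1) :
    fermiEnergyOf Δ a b c ν ≤ fermiEnergyOf Δ a' b c ν := by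
  obtain ⟨e1, -, he1⟩ := exists_fermiEnergy_of_mem_Ioo hΔ ha.ne' hc hb hν0 hν1
  obtain ⟨e2, -, he2⟩ := exists_fermiEnergy_of_mem_Ioo hΔ (lt_of_lt_of_le ha haa).ne' hc hb hν0 hν1
  exact fermiEnergyOf_mono_tpdSq hΔ.le hc hb (pow_le_pow_left₀ ha.le haa 2) hν0 hν1 ⟨e1, he1⟩ ⟨e2, he2⟩

/-- `ε_F` is non-increasing in `Δ`, endpoint form, certificate-free: `Δ ≤ Δ′ ⇒ ε_F(Δ′) ≤ ε_F(Δ)`. [folklore] -/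
theorem fermiEnergyOf_anti_Delta' {Δ' : ℝ} (hΔ : 0 < Δ) (hΔΔ : Δ ≤ Δ') (ha : a ≠ 0) (hc : 0 ≤ c) (hb : 0 ≤ b) (hν0 : 0 < ν) (hν1 : ν < 1) :
    fermiEnergyOf Δ' a b c ν ≤ fermiEnergyOf Δ a b c ν := by
  obtain ⟨e1, -, he1⟩ := exists_fermiEnergy_of_mem_Ioo hΔ ha hc hb hν0 hν1
  obtain ⟨e2, -, he2⟩ := exists_fermiEnergy_of_mem_Ioo (lt_of_lt_of_le hΔ hΔΔ) ha hc hb hν0 hν1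
  have h := fermiEnergyOf_shift_le (δ := Δ' - Δ) hΔ ha hc hb (by linarith) hν0 hν1 ⟨e1, he1⟩
    (by rw [show Δ + (Δ' - Δ) = Δ' by ring]; exact ⟨e2, he2⟩)
  rwa [show Δ + (Δ' - Δ) = Δ' by ring] at h

/-- The Δ-lever of the shape in endpoint form, certificate-free: `Δ ≤ Δ′`, regime at `Δ` ⇒ `R(Δ) ≤ R(Δ′)`. [folklore] -/
theorem fsRatio_fermiEnergyOf_mono_Delta' {Δ' : ℝ} (hΔ : 0 < Δ) (hΔΔ : Δ ≤ Δ') (ha : a ≠ 0) (hb : 0 < b) (hc : 0 ≤ c) (hcb : c ≤ b)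
    (hν0 : 0 < ν) (hν1 : ν < 1) (hreg : c * fermiEnergyOf Δ a b c ν ≤ a ^ 2) :
    fsRatio Δ a b c (fermiEnergyOf Δ a b c ν) ≤ fsRatio Δ' a b c (fermiEnergyOf Δ' a b c ν) := by
  obtain ⟨e1, -, he1⟩ := exists_fermiEnergy_of_mem_Ioo hΔ ha hc hb.le hν0 hν1
  obtain ⟨e2, -, he2⟩ := exists_fermiEnergy_of_mem_Ioo (lt_of_lt_of_le hΔ hΔΔ) ha hc hb.le hν0 hν1
  have h := fsRatio_fermiEnergyOf_mono_Delta (δ := Δ' - Δ) hΔ ha hb hc hcb (by linarith) hν0 hν1 ⟨e1, he1⟩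
    (by rw [show Δ + (Δ' - Δ) = Δ' by ring]; exact ⟨e2, he2⟩) hreg
  rwa [show Δ + (Δ' - Δ) = Δ' by ring] at h

/-- The conditional `t_pp′` lever in endpoint-and-corner form (certificate inputs): `0 ≤ c ≤ c′ ≤ t_pp`, regime `c′·ε_F(c) ≤ t_pd²`, a bracket
`e₁ ≤ ε_F(c′)`, `ε_F(c) ≤ e₂` with `dopingDisc(c′; ·, ·) ≤ 0` at its four corners ⇒ `R(c′) ≤ R(c)`. [folklore] -/
theorem fsRatio_fermiEnergyOf_anti_tppP_of_corners' {c' e₁ e₂ : ℝ} (hΔ : 0 < Δ) (ha : a ≠ 0) (hb : 0 < b) (hc : 0 ≤ c) (hcc : c ≤ c')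
    (hcb : c' ≤ b) (hν0 : 0 < ν) (hν1 : ν < 1) (hreg : c' * fermiEnergyOf Δ a b c ν ≤ a ^ 2)
    (he₁ : e₁ ≤ fermiEnergyOf Δ a b c' ν) (he₂ : fermiEnergyOf Δ a b c ν ≤ e₂)
    (haa : dopingDisc Δ a b c' e₁ e₁ ≤ 0) (hab : dopingDisc Δ a b c' e₁ e₂ ≤ 0)
    (hba : dopingDisc Δ a b c' e₂ e₁ ≤ 0) (hbb : dopingDisc Δ a b c' e₂ e₂ ≤ 0) :
    fsRatio Δ a b c' (fermiEnergyOf Δ a b c' ν) ≤ fsRatio Δ a b c (fermiEnergyOf Δ a b c ν) := by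
  obtain ⟨γ, rfl⟩ : ∃ γ, c' = c + γ := ⟨c' - c, by ring⟩
  exact fsRatio_fermiEnergyOf_anti_tppP_of_corners hΔ ha hb hc (by linarith) hcb hν0 hν1 hreg he₁ he₂ haa hab hba hbb

end Conveniences

/-! ## §1 The two-ray rule -/

section TwoRay

variable {Δ a b c ν : ℝ}

/-- **LOWER RAY**: for `Δ₁ ≤ Δ`, `a₁ ≤ t_pd`, `t_pp ≤ b₂`, `0 ≤ t_pp′ ≤ t_pp` and the regime at the oxygen-rich row,
`R(Δ₁, a₁, b₂, t_pp′·b₂/t_pp) ≤ R(Δ, t_pd, t_pp, t_pp′)`. [folklore] -/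
theorem fsRatio_fermiEnergyOf_twoRay_lower {Δ₁ a₁ b₂ : ℝ} (hΔ₁ : 0 < Δ₁) (hΔ : Δ₁ ≤ Δ) (ha₁ : 0 < a₁) (ha : a₁ ≤ a) (hb : 0 < b) (hb₂ : b ≤ b₂)
    (hc : 0 ≤ c) (hcb : c ≤ b) (hν0 : 0 < ν) (hν1 : ν < 1)
    (hreg : (c * b₂ / b) * fermiEnergyOf Δ₁ a₁ b₂ (c * b₂ / b) ν ≤ a₁ ^ 2) :
    fsRatio Δ₁ a₁ b₂ (c * b₂ / b) (fermiEnergyOf Δ₁ a₁ b₂ (c * b₂ / b) ν) ≤ fsRatio Δ a b c (fermiEnergyOf Δ a b c ν) := by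
  have ha0 : 0 < a := lt_of_lt_of_le ha₁ ha
  -- regime at (Δ₁, a₁, b, c) from the oxygen-ray bracket: c·ε_F(b, c) ≤ (c b₂/b)·ε_F(b₂, c b₂/b)
  have hreg' : c * fermiEnergyOf Δ₁ a₁ b c ν ≤ a₁ ^ 2 := by
    have hl : 1 ≤ b₂ / b := by rw [le_div_iff₀ hb]; linarith
    have h := fermiEnergyOf_le_ray (l := b₂ / b) hΔ₁ ha₁ hc hb.le hl hν0 hν1
    rw [show b₂ / b * b = b₂ by field_simp, show b₂ / b * c = c * b₂ / b by field_simp] at h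
    calc c * fermiEnergyOf Δ₁ a₁ b c ν ≤ c * (b₂ / b * fermiEnergyOf Δ₁ a₁ b₂ (c * b₂ / b) ν) := mul_le_mul_of_nonneg_left h hc
      _ = c * b₂ / b * fermiEnergyOf Δ₁ a₁ b₂ (c * b₂ / b) ν := by field_simp
      _ ≤ a₁ ^ 2 := hreg
  -- step 1: down the oxygen ray
  have s1 := fsRatio_fermiEnergyOf_ray_anti' hΔ₁ ha₁ hb hb₂ hc hcb hν0 hν1 hreg
  -- step 2: raise t_pd from a₁ to a
  have s2 := fsRatio_fermiEnergyOf_mono_tpd' hΔ₁ ha₁ ha hb hc hcb hν0 hν1 hreg'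
  -- step 3: raise Δ from Δ₁ to Δ (regime at (Δ₁, a, b, c) propagated from a₁)
  have s3 := fsRatio_fermiEnergyOf_mono_Delta' hΔ₁ hΔ ha0.ne' hb hc hcb hν0 hν1 (sheetRegime_mono_tpd' hΔ₁ ha₁ ha hc hb.le hν0 hν1 hreg')
  exact s1.trans (s2.trans s3)

/-- **UPPER RAY**: for `Δ ≤ Δ₂`, `t_pd ≤ a₂`, `b₁ ≤ t_pp`, `0 ≤ t_pp′ ≤ t_pp` and the regime at the member,
`R(Δ, t_pd, t_pp, t_pp′) ≤ R(Δ₂, a₂, b₁, t_pp′·b₁/t_pp)`. [folklore] -/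
theorem fsRatio_fermiEnergyOf_twoRay_upper {Δ₂ a₂ b₁ : ℝ} (hΔ : 0 < Δ) (hΔ₂ : Δ ≤ Δ₂) (ha : 0 < a) (ha₂ : a ≤ a₂) (hb₁ : 0 < b₁) (hb : b₁ ≤ b)
    (hc : 0 ≤ c) (hcb : c ≤ b) (hν0 : 0 < ν) (hν1 : ν < 1) (hreg : c * fermiEnergyOf Δ a b c ν ≤ a ^ 2) :
    fsRatio Δ a b c (fermiEnergyOf Δ a b c ν) ≤ fsRatio Δ₂ a₂ b₁ (c * b₁ / b) (fermiEnergyOf Δ₂ a₂ b₁ (c * b₁ / b) ν) := by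
  have hΔ₂0 : 0 < Δ₂ := lt_of_lt_of_le hΔ hΔ₂
  have hb0 : 0 < b := lt_of_lt_of_le hb₁ hb
  -- step 1: raise Δ to Δ₂
  have s1 := fsRatio_fermiEnergyOf_mono_Delta' hΔ hΔ₂ ha.ne' hb0 hc hcb hν0 hν1 hreg
  -- regime at (Δ₂, a, b, c)
  have hreg2 : c * fermiEnergyOf Δ₂ a b c ν ≤ a ^ 2 :=
    le_trans (mul_le_mul_of_nonneg_left (fermiEnergyOf_anti_Delta' hΔ hΔ₂ ha.ne' hc hb0.le hν0 hν1) hc) hreg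
  -- step 2: raise t_pd to a₂
  have s2 := fsRatio_fermiEnergyOf_mono_tpd' hΔ₂0 ha ha₂ hb0 hc hcb hν0 hν1 hreg2
  -- regime at (Δ₂, a₂, b, c)
  have hreg3 : c * fermiEnergyOf Δ₂ a₂ b c ν ≤ a₂ ^ 2 := sheetRegime_mono_tpd' hΔ₂0 ha ha₂ hc hb0.le hν0 hν1 hreg2
  -- step 3: (Δ₂, a₂, b, c) is the ray image of (Δ₂, a₂, b₁, c b₁/b) by the factor b/b₁ ≥ 1
  have hcb₁ : c * b₁ / b ≤ b₁ := by
    rw [div_le_iff₀ hb0]; nlinarith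
  have hkey : c * b₁ / b * b / b₁ = c := by field_simp
  have s3 := fsRatio_fermiEnergyOf_ray_anti' (b := b₁) (b' := b) (c := c * b₁ / b) hΔ₂0 (lt_of_lt_of_le ha ha₂) hb₁ hb (by positivity) hcb₁
    hν0 hν1 (by rw [hkey]; exact hreg3)
  rw [hkey] at s3
  exact s1.trans (s2.trans s3)

/-- **THE TWO-RAY RULE** over the box `[Δ₁, Δ₂] × [a₁, a₂] × [b₁, b₂] × [c₁, c₂]` (`c₂ ≤ b₁`), under the single regime hypothesis
`c₂·b₂·ε_F(Δ₁, a₂, b₂, c₁; ν) ≤ a₁²·b₁`: every member is squeezed between the two rows on its own oxygen ray. [folklore] -/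
theorem fsRatio_fermiEnergyOf_twoRay {Δ₁ Δ₂ a₁ a₂ b₁ b₂ c₁ c₂ : ℝ} (hΔ₁ : 0 < Δ₁) (ha₁ : 0 < a₁) (hb₁ : 0 < b₁) (hc₁ : 0 ≤ c₁) (hc₂b : c₂ ≤ b₁)
    (hΔ : Δ ∈ Icc Δ₁ Δ₂) (ha : a ∈ Icc a₁ a₂) (hb : b ∈ Icc b₁ b₂) (hc : c ∈ Icc c₁ c₂) (hν0 : 0 < ν) (hν1 : ν < 1)
    (hreg : c₂ * b₂ * fermiEnergyOf Δ₁ a₂ b₂ c₁ ν ≤ a₁ ^ 2 * b₁) :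
    fsRatio Δ₁ a₁ b₂ (c * b₂ / b) (fermiEnergyOf Δ₁ a₁ b₂ (c * b₂ / b) ν) ≤ fsRatio Δ a b c (fermiEnergyOf Δ a b c ν) ∧
      fsRatio Δ a b c (fermiEnergyOf Δ a b c ν) ≤ fsRatio Δ₂ a₂ b₁ (c * b₁ / b) (fermiEnergyOf Δ₂ a₂ b₁ (c * b₁ / b) ν) := by
  obtain ⟨hΔl, hΔu⟩ := hΔ
  obtain ⟨hal, hau⟩ := ha
  obtain ⟨hbl, hbu⟩ := hb
  obtain ⟨hcl, hcu⟩ := hc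
  have hΔ0 : 0 < Δ := lt_of_lt_of_le hΔ₁ hΔl
  have ha0 : 0 < a := lt_of_lt_of_le ha₁ hal
  have hb0 : 0 < b := lt_of_lt_of_le hb₁ hbl
  have hc0 : 0 ≤ c := hc₁.trans hcl
  have hc₂ : 0 ≤ c₂ := hc0.trans hcu
  have hcb : c ≤ b := hcu.trans (hc₂b.trans hbl)
  have ha₂ : 0 < a₂ := lt_of_lt_of_le ha0 hau
  have hb₂ : 0 < b₂ := lt_of_lt_of_le hb0 hbu
  -- the top Fermi energy of the box
  have hEt0 : 0 ≤ fermiEnergyOf Δ₁ a₂ b₂ c₁ ν := (fermiEnergyOf_pos hΔ₁ ha₂.ne' hc₁ hb₂.le hν0 hν1).le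
  -- member regime: ε_F(θ) ≤ Et and c ≤ c₂, c₂ Et ≤ a₁² b₁/b₂ ≤ a₁² ≤ a²
  have hmem : fermiEnergyOf Δ a b c ν ≤ fermiEnergyOf Δ₁ a₂ b₂ c₁ ν :=
    (fermiEnergyOf_mem_Icc_of_mem_box' (c₂ := c) hΔ₁ ha₁ hb₁.le hc₁ ⟨hΔl, hΔu⟩ ⟨hal, hau⟩ ⟨hbl, hbu⟩ ⟨hcl, le_rfl⟩ hν0 hν1).2
  have hc₂Et : c₂ * fermiEnergyOf Δ₁ a₂ b₂ c₁ ν ≤ a₁ ^ 2 := by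
    have h1 : c₂ * fermiEnergyOf Δ₁ a₂ b₂ c₁ ν * b₂ ≤ a₁ ^ 2 * b₁ := by
      rw [mul_right_comm]; exact hreg
    have h2 : a₁ ^ 2 * b₁ ≤ a₁ ^ 2 * b₂ := mul_le_mul_of_nonneg_left (hbl.trans hbu) (sq_nonneg a₁)
    exact le_of_mul_le_mul_right (h1.trans h2) hb₂
  have hreg_mem : c * fermiEnergyOf Δ a b c ν ≤ a ^ 2 := by
    have h1 : c * fermiEnergyOf Δ a b c ν ≤ c₂ * fermiEnergyOf Δ₁ a₂ b₂ c₁ ν :=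
      mul_le_mul hcu hmem (fermiEnergyOf_pos hΔ0 ha0.ne' hc0 hb0.le hν0 hν1).le hc₂
    have h2 : a₁ ^ 2 ≤ a ^ 2 := pow_le_pow_left₀ ha₁.le hal 2
    exact h1.trans (hc₂Et.trans h2)
  -- oxygen-rich row regime: (c b₂/b)·ε_F(Δ₁, a₁, b₂, c b₂/b) ≤ (c₂ b₂/b₁)·Et ≤ a₁²
  have hcray : c ≤ c * b₂ / b := by
    rw [le_div_iff₀ hb0]; exact mul_le_mul_of_nonneg_left hbu hc0
  have hcray' : c * b₂ / b ≤ c₂ * b₂ / b₁ := by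
    rw [div_le_div_iff₀ hb0 hb₁]
    have h : c * b₁ ≤ c₂ * b := mul_le_mul hcu hbl hb₁.le hc₂
    calc c * b₂ * b₁ = c * b₁ * b₂ := by ring
      _ ≤ c₂ * b * b₂ := mul_le_mul_of_nonneg_right h hb₂.le
      _ = c₂ * b₂ * b := by ring
  have hErow : fermiEnergyOf Δ₁ a₁ b₂ (c * b₂ / b) ν ≤ fermiEnergyOf Δ₁ a₂ b₂ c₁ ν :=
    calc fermiEnergyOf Δ₁ a₁ b₂ (c * b₂ / b) ν ≤ fermiEnergyOf Δ₁ a₁ b₂ c₁ ν :=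
          fermiEnergyOf_anti_tppP' hΔ₁ ha₁.ne' hc₁ (hcl.trans hcray) hb₂.le hν0 hν1
      _ ≤ fermiEnergyOf Δ₁ a₂ b₂ c₁ ν := fermiEnergyOf_mono_tpd' hΔ₁ ha₁ (hal.trans hau) hc₁ hb₂.le hν0 hν1
  have hreg_ray : c * b₂ / b * fermiEnergyOf Δ₁ a₁ b₂ (c * b₂ / b) ν ≤ a₁ ^ 2 := by
    have h0 : 0 ≤ fermiEnergyOf Δ₁ a₁ b₂ (c * b₂ / b) ν := (fermiEnergyOf_pos hΔ₁ ha₁.ne' (hc0.trans hcray) hb₂.le hν0 hν1).le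
    have hq : 0 ≤ c₂ * b₂ / b₁ := by positivity
    have h1 : c * b₂ / b * fermiEnergyOf Δ₁ a₁ b₂ (c * b₂ / b) ν ≤ c₂ * b₂ / b₁ * fermiEnergyOf Δ₁ a₂ b₂ c₁ ν :=
      mul_le_mul hcray' hErow h0 hq
    have h2 : c₂ * b₂ / b₁ * fermiEnergyOf Δ₁ a₂ b₂ c₁ ν ≤ a₁ ^ 2 := by
      rw [div_mul_eq_mul_div, div_le_iff₀ hb₁]; exact hreg
    exact h1.trans h2
  exact ⟨fsRatio_fermiEnergyOf_twoRay_lower hΔ₁ hΔl ha₁ hal hb0 hbu hc0 hcb hν0 hν1 hreg_ray,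
    fsRatio_fermiEnergyOf_twoRay_upper hΔ0 hΔu ha0 hau hb₁ hbl hc0 hcb hν0 hν1 hreg_mem⟩

end TwoRay

/-! ## §2 Pure boxes: the exact two-corner rule -/

/-- **PURE BOX — TWO TRUE CORNERS, NO REGIME HYPOTHESIS**: for `t_pp′ = 0` rows over `[Δ₁, Δ₂] × [a₁, a₂] × [b₁, b₂]`,
`R ∈ [R(Δ₁, a₁, b₂, 0), R(Δ₂, a₂, b₁, 0)]`. [folklore] -/
theorem fsRatio_fermiEnergyOf_mem_Icc_pureBox {Δ a b Δ₁ Δ₂ a₁ a₂ b₁ b₂ ν : ℝ} (hΔ₁ : 0 < Δ₁) (ha₁ : 0 < a₁) (hb₁ : 0 < b₁)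
    (hΔ : Δ ∈ Icc Δ₁ Δ₂) (ha : a ∈ Icc a₁ a₂) (hb : b ∈ Icc b₁ b₂) (hν0 : 0 < ν) (hν1 : ν < 1) :
    fsRatio Δ a b 0 (fermiEnergyOf Δ a b 0 ν) ∈
      Icc (fsRatio Δ₁ a₁ b₂ 0 (fermiEnergyOf Δ₁ a₁ b₂ 0 ν)) (fsRatio Δ₂ a₂ b₁ 0 (fermiEnergyOf Δ₂ a₂ b₁ 0 ν)) := by
  have h := fsRatio_fermiEnergyOf_twoRay (c := 0) (c₁ := 0) (c₂ := 0) hΔ₁ ha₁ hb₁ le_rfl hb₁.le hΔ ha hb ⟨le_rfl, le_rfl⟩ hν0 hν1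
    (by rw [zero_mul, zero_mul]; positivity)
  simp only [zero_mul, zero_div] at h
  exact h

/-! ## §3 Fixed-ratio boxes: two true corners on the κ-ray -/

/-- **FIXED-RATIO BOX — TWO TRUE CORNERS**: if every member has `t_pp′ = κ·t_pp` (`0 ≤ κ`, `κb₂ ≤ b₁`… stated as `κ·b₂ ≤ b₁`) then over
`[Δ₁, Δ₂] × [a₁, a₂] × [b₁, b₂]`: `R ∈ [R(Δ₁, a₁, b₂, κb₂), R(Δ₂, a₂, b₁, κb₁)]` (regime `κb₂·b₂·ε_F(Δ₁, a₂, b₂, κb₁) ≤ a₁²·b₁`). [folklore] -/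
theorem fsRatio_fermiEnergyOf_mem_Icc_fixedRatioBox {Δ a b κ Δ₁ Δ₂ a₁ a₂ b₁ b₂ ν : ℝ} (hΔ₁ : 0 < Δ₁) (ha₁ : 0 < a₁) (hb₁ : 0 < b₁) (hκ : 0 ≤ κ)
    (hκb : κ * b₂ ≤ b₁) (hΔ : Δ ∈ Icc Δ₁ Δ₂) (ha : a ∈ Icc a₁ a₂) (hb : b ∈ Icc b₁ b₂) (hν0 : 0 < ν) (hν1 : ν < 1)
    (hreg : κ * b₂ * b₂ * fermiEnergyOf Δ₁ a₂ b₂ (κ * b₁) ν ≤ a₁ ^ 2 * b₁) :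
    fsRatio Δ a b (κ * b) (fermiEnergyOf Δ a b (κ * b) ν) ∈
      Icc (fsRatio Δ₁ a₁ b₂ (κ * b₂) (fermiEnergyOf Δ₁ a₁ b₂ (κ * b₂) ν)) (fsRatio Δ₂ a₂ b₁ (κ * b₁) (fermiEnergyOf Δ₂ a₂ b₁ (κ * b₁) ν)) := by
  have hb0 : 0 < b := lt_of_lt_of_le hb₁ hb.1
  have hcmem : κ * b ∈ Icc (κ * b₁) (κ * b₂) := ⟨mul_le_mul_of_nonneg_left hb.1 hκ, mul_le_mul_of_nonneg_left hb.2 hκ⟩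
  have h := fsRatio_fermiEnergyOf_twoRay (c := κ * b) (c₁ := κ * b₁) (c₂ := κ * b₂) hΔ₁ ha₁ hb₁ (by positivity) hκb hΔ ha hb hcmem hν0 hν1 hreg
  rwa [show κ * b * b₂ / b = κ * b₂ by field_simp, show κ * b * b₁ / b = κ * b₁ by field_simp] at h

/-! ## §4 General boxes: two virtual corners -/

/-- **GENERAL BOX — TWO VIRTUAL CORNERS** `V_lo = (Δ₁, a₁, b₂, c₂b₂/b₁)`, `V_hi = (Δ₂, a₂, b₁, c₁b₁/b₂)`: for every member of
`[Δ₁, Δ₂] × [a₁, a₂] × [b₁, b₂] × [c₁, c₂]` (`c₂ ≤ b₁`), **`R(V_lo) ≤ R(θ) ≤ R(V_hi)`**, given (i) the regime `c₂b₂·ε_F(Δ₁, a₂, b₂, c₁) ≤ a₁²b₁`;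
(ii) LOWER CLOSURE: a bracket `e₁ ≤ ε_F(V_lo)`, `ε_F(Δ₁, a₁, b₂, c₁) ≤ e₂` with `dopingDisc(V_lo; ·, ·) ≤ 0` at its four corners; (iii) UPPER CLOSURE: `ε_F(V_hi) ≤ e₄`,
`c₂e₄ ≤ a₂²`, `c₂Δ₂ ≤ a₂²` and the slab inequality `a₂²[b₁²Δ₂ − 2(c₁b₁/b₂ + b₁)(a₂² − c₂Δ₂) + 4c₂(c₂ + b₁)e₄] + c₂b₁²e₄² ≤ 0`. [folklore] -/
theorem fsRatio_fermiEnergyOf_mem_Icc_virtualCorners {Δ a b c Δ₁ Δ₂ a₁ a₂ b₁ b₂ c₁ c₂ e₁ e₂ e₄ ν : ℝ} (hΔ₁ : 0 < Δ₁) (ha₁ : 0 < a₁)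
    (hb₁ : 0 < b₁) (hc₁ : 0 ≤ c₁) (hc₂b : c₂ ≤ b₁)
    (hΔ : Δ ∈ Icc Δ₁ Δ₂) (ha : a ∈ Icc a₁ a₂) (hb : b ∈ Icc b₁ b₂) (hc : c ∈ Icc c₁ c₂) (hν0 : 0 < ν) (hν1 : ν < 1)
    (hreg : c₂ * b₂ * fermiEnergyOf Δ₁ a₂ b₂ c₁ ν ≤ a₁ ^ 2 * b₁)
    (he₁ : e₁ ≤ fermiEnergyOf Δ₁ a₁ b₂ (c₂ * b₂ / b₁) ν) (he₂ : fermiEnergyOf Δ₁ a₁ b₂ c₁ ν ≤ e₂)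
    (hd₁₁ : dopingDisc Δ₁ a₁ b₂ (c₂ * b₂ / b₁) e₁ e₁ ≤ 0) (hd₁₂ : dopingDisc Δ₁ a₁ b₂ (c₂ * b₂ / b₁) e₁ e₂ ≤ 0)
    (hd₂₁ : dopingDisc Δ₁ a₁ b₂ (c₂ * b₂ / b₁) e₂ e₁ ≤ 0) (hd₂₂ : dopingDisc Δ₁ a₁ b₂ (c₂ * b₂ / b₁) e₂ e₂ ≤ 0)
    (he₄ : fermiEnergyOf Δ₂ a₂ b₁ (c₁ * b₁ / b₂) ν ≤ e₄) (hreg₄ : c₂ * e₄ ≤ a₂ ^ 2) (hcap : c₂ * Δ₂ ≤ a₂ ^ 2)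
    (hslab : a₂ ^ 2 * (b₁ ^ 2 * Δ₂ - 2 * (c₁ * b₁ / b₂ + b₁) * (a₂ ^ 2 - c₂ * Δ₂) + 4 * c₂ * (c₂ + b₁) * e₄) + c₂ * b₁ ^ 2 * e₄ ^ 2 ≤ 0) :
    fsRatio Δ a b c (fermiEnergyOf Δ a b c ν) ∈
      Icc (fsRatio Δ₁ a₁ b₂ (c₂ * b₂ / b₁) (fermiEnergyOf Δ₁ a₁ b₂ (c₂ * b₂ / b₁) ν))
        (fsRatio Δ₂ a₂ b₁ (c₁ * b₁ / b₂) (fermiEnergyOf Δ₂ a₂ b₁ (c₁ * b₁ / b₂) ν)) := by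
  obtain ⟨hlo, hup⟩ := fsRatio_fermiEnergyOf_twoRay hΔ₁ ha₁ hb₁ hc₁ hc₂b hΔ ha hb hc hν0 hν1 hreg
  obtain ⟨hΔl, hΔu⟩ := hΔ
  obtain ⟨hal, hau⟩ := ha
  obtain ⟨hbl, hbu⟩ := hb
  obtain ⟨hcl, hcu⟩ := hc
  have hΔ₂ : 0 < Δ₂ := lt_of_lt_of_le hΔ₁ (hΔl.trans hΔu)
  have ha0 : 0 < a := lt_of_lt_of_le ha₁ hal
  have ha₂ : 0 < a₂ := lt_of_lt_of_le ha0 hau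
  have hb0 : 0 < b := lt_of_lt_of_le hb₁ hbl
  have hb₂ : 0 < b₂ := lt_of_lt_of_le hb0 hbu
  have hc0 : 0 ≤ c := hc₁.trans hcl
  have hc₂ : 0 ≤ c₂ := hc0.trans hcu
  -- positions of the two ray rows inside the slabs
  have hcray : c ≤ c * b₂ / b := by
    rw [le_div_iff₀ hb0]; exact mul_le_mul_of_nonneg_left hbu hc0
  have hcray' : c * b₂ / b ≤ c₂ * b₂ / b₁ := by
    rw [div_le_div_iff₀ hb0 hb₁]
    have h : c * b₁ ≤ c₂ * b := mul_le_mul hcu hbl hb₁.le hc₂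
    calc c * b₂ * b₁ = c * b₁ * b₂ := by ring
      _ ≤ c₂ * b * b₂ := mul_le_mul_of_nonneg_right h hb₂.le
      _ = c₂ * b₂ * b := by ring
  have hvlo_b : c₂ * b₂ / b₁ ≤ b₂ := by
    rw [div_le_iff₀ hb₁, mul_comm]; exact mul_le_mul_of_nonneg_left hc₂b hb₂.le
  have hcup : c₁ * b₁ / b₂ ≤ c * b₁ / b := by
    rw [div_le_div_iff₀ hb₂ hb0]
    have h : c₁ * b ≤ c * b₂ := mul_le_mul hcl hbu hb0.le hc0
    calc c₁ * b₁ * b = c₁ * b * b₁ := by ring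
      _ ≤ c * b₂ * b₁ := mul_le_mul_of_nonneg_right h hb₁.le
      _ = c * b₁ * b₂ := by ring
  have hcup' : c * b₁ / b ≤ c := by
    rw [div_le_iff₀ hb0]; exact mul_le_mul_of_nonneg_left hbl hc0
  have hcup0 : 0 ≤ c₁ * b₁ / b₂ := by positivity
  constructor
  · -- LOWER CLOSURE: R(V_lo) ≤ R(Δ₁, a₁, b₂, c b₂/b) by the conditional t_pp′ lever at the fixed row V_lo
    refine le_trans ?_ hlo
    have hE2 : fermiEnergyOf Δ₁ a₁ b₂ (c * b₂ / b) ν ≤ e₂ :=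
      (fermiEnergyOf_anti_tppP' hΔ₁ ha₁.ne' hc₁ (hcl.trans hcray) hb₂.le hν0 hν1).trans he₂
    have hErow : fermiEnergyOf Δ₁ a₁ b₂ (c * b₂ / b) ν ≤ fermiEnergyOf Δ₁ a₂ b₂ c₁ ν :=
      calc fermiEnergyOf Δ₁ a₁ b₂ (c * b₂ / b) ν ≤ fermiEnergyOf Δ₁ a₁ b₂ c₁ ν :=
            fermiEnergyOf_anti_tppP' hΔ₁ ha₁.ne' hc₁ (hcl.trans hcray) hb₂.le hν0 hν1
        _ ≤ fermiEnergyOf Δ₁ a₂ b₂ c₁ ν := fermiEnergyOf_mono_tpd' hΔ₁ ha₁ (hal.trans hau) hc₁ hb₂.le hν0 hν1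
    have hregV : c₂ * b₂ / b₁ * fermiEnergyOf Δ₁ a₁ b₂ (c * b₂ / b) ν ≤ a₁ ^ 2 := by
      have hq : 0 ≤ c₂ * b₂ / b₁ := by positivity
      have h1 : c₂ * b₂ / b₁ * fermiEnergyOf Δ₁ a₁ b₂ (c * b₂ / b) ν ≤ c₂ * b₂ / b₁ * fermiEnergyOf Δ₁ a₂ b₂ c₁ ν :=
        mul_le_mul_of_nonneg_left hErow hq
      have h2 : c₂ * b₂ / b₁ * fermiEnergyOf Δ₁ a₂ b₂ c₁ ν ≤ a₁ ^ 2 := by rw [div_mul_eq_mul_div, div_le_iff₀ hb₁]; exact hreg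
      exact h1.trans h2
    exact fsRatio_fermiEnergyOf_anti_tppP_of_corners' hΔ₁ ha₁.ne' hb₂ (hc0.trans hcray) hcray' hvlo_b hν0 hν1 hregV he₁ hE2 hd₁₁ hd₁₂ hd₂₁ hd₂₂
  · -- UPPER CLOSURE: R(Δ₂, a₂, b₁, c b₁/b) ≤ R(V_hi) by the conditional t_pp′ lever on the slab (Δ₂, a₂, b₁, ·)
    refine le_trans hup ?_
    have hEhi0 : 0 < fermiEnergyOf Δ₂ a₂ b₁ (c₁ * b₁ / b₂) ν := fermiEnergyOf_pos hΔ₂ ha₂.ne' hcup0 hb₁.le hν0 hν1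
    have hEmid : fermiEnergyOf Δ₂ a₂ b₁ (c * b₁ / b) ν ≤ fermiEnergyOf Δ₂ a₂ b₁ (c₁ * b₁ / b₂) ν :=
      fermiEnergyOf_anti_tppP' hΔ₂ ha₂.ne' hcup0 hcup hb₁.le hν0 hν1
    have hEmid0 : 0 < fermiEnergyOf Δ₂ a₂ b₁ (c * b₁ / b) ν := fermiEnergyOf_pos hΔ₂ ha₂.ne' (hcup0.trans hcup) hb₁.le hν0 hν1
    have hregU : c * b₁ / b * fermiEnergyOf Δ₂ a₂ b₁ (c₁ * b₁ / b₂) ν ≤ a₂ ^ 2 := by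
      have h1 : c * b₁ / b * fermiEnergyOf Δ₂ a₂ b₁ (c₁ * b₁ / b₂) ν ≤ c₂ * e₄ :=
        mul_le_mul (hcup'.trans hcu) he₄ hEhi0.le hc₂
      exact h1.trans hreg₄
    refine fsRatio_fermiEnergyOf_anti_tppP' hΔ₂ ha₂.ne' hb₁ hcup0 hcup (hcup'.trans (hcu.trans hc₂b)) hν0 hν1 hregU ?_
    exact dopingDisc_nonpos_on_slab (c₁ := c₁ * b₁ / b₂) (c₂ := c₂) (e := e₄) hΔ₂.le hb₁.le hcup0 ⟨hcup, hcup'.trans hcu⟩ hc₂b hcap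
      ⟨hEmid0.le, hEmid.trans he₄⟩ ⟨hEhi0.le, he₄⟩ hslab

end Summit.Ventures.CertifiedManyBodySolver.Downfold.Emery
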